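import Mathlib.MeasureTheory.Integral.Bochner.Set
import Mathlib.MeasureTheory.Measure.OpenPos
import Mathlib.MeasureTheory.Measure.Real
import Mathlib.Topology.LocallyConstant.Basic
import Mathlib.Topology.Algebra.ConstMulAction
import Mathlib.Analysis.RCLike.Basic
import HarnessLib

/-!
# A function constant near a rigid fibre of `Q`, whose `Q`-push-forward vanishes near the image point, vanishes there

Topic `NumberTheory/Automorphic`; namespace `Literature.NumberTheory.Automorphic`.  KERNEL ONLY: generic topology /
measure theory (Mathlib only); 0 definitions, 0 named facts, 0 `sorry`.

Setting.  `X` a topological space with a measure `μ` (Borel sets measurable, `OpensMeasurableSpace X`), `Y` a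
topological space, `Q : X → Y` continuous, `φ : X → 𝕜` (`𝕜 = ℝ` or `ℂ`, `RCLike 𝕜`) with compact support
(`HasCompactSupport φ`), a point `u₀ : X` and an OPEN set `S ⊆ X` on which `φ` is constant, `φ u = φ u₀` for
`u ∈ S`, and which contains the part of the fibre of `Q` through `u₀` that lies in the support:
`{u ∈ tsupport φ | Q u = Q u₀} ⊆ S` ("rigid fibre").  Typical instance: `φ` locally constant and constant along the
fibre, `S := {u | φ u = φ u₀}` (the `…_of_isLocallyConstant_…` corollaries).

* §1 `exists_isOpen_preimage_inter_tsupport_subset` (`Y` Hausdorff): there is an open `B ∋ Q u₀` with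
  `Q⁻¹(B) ∩ tsupport φ ⊆ S` — the compact set `Q(tsupport φ \ S)` misses `Q u₀`, take its complement.
* §2 `setIntegral_preimage_eq_measureReal_smul`: for such `B`, `∫_{Q⁻¹ B} φ dμ = μ(Q⁻¹ B ∩ tsupport φ) • φ u₀`
  (the integrand is `φ u₀ · 1_{Q⁻¹B ∩ tsupport φ}`, `indicator_comp_mul_eq_indicator_const`); the same for the
  integrand `1_B(Q u) φ(u)` (`integral_indicator_comp_mul_eq_measureReal_smul`; the two forms agree,
  `integral_indicator_comp_mul_eq_setIntegral_preimage`); and `measureReal_preimage_inter_tsupport_pos`: if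
  `u₀ ∈ S`, `φ u₀ ≠ 0`, `μ` is positive on non-empty open sets and finite on compact sets, then
  `0 < μ.real (Q⁻¹ B ∩ tsupport φ)` for every open `B ∋ Q u₀`.
* §3 MAIN `eq_zero_of_forall_exists_setIntegral_preimage_eq_zero`: if arbitrarily small open `B ∋ Q u₀` have
  `∫_{Q⁻¹ B} φ dμ = 0` (`∀ B₀ ∈ 𝓝 (Q u₀), ∃ B ⊆ B₀, IsOpen B ∧ Q u₀ ∈ B ∧ ∫ u in Q ⁻¹' B, φ u ∂μ = 0`), then
  `φ u₀ = 0`.  Variants: all open `B ∋ Q u₀` (`eq_zero_of_forall_isOpen_setIntegral_preimage_eq_zero`); the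
  integrand `1_B(Q u) φ(u)` (`eq_zero_of_forall_exists_integral_indicator_comp_mul_eq_zero`); `φ` locally constant
  with `S = {φ = φ u₀}` (`eq_zero_of_isLocallyConstant_of_forall_exists_setIntegral_preimage_eq_zero`); and, for `Y`
  a topological additive group with a family of open sets `s i ∋ 0` shrinking to `0`, vanishing on the translates
  `Q⁻¹(Q u₀ +ᵥ s i)` (`eq_zero_of_forall_setIntegral_preimage_vadd_eq_zero`,
  `eq_zero_of_isLocallyConstant_of_forall_setIntegral_preimage_vadd_eq_zero`) — the shape in which the tree's
  `setIntegral_preimage_vadd_piPrimePowBall_eq_zero` (`LocalPiFourierStieltjesUniqueness`) delivers the hypothesis,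
  with `s N = (𝔭^N)^ι` (`isOpen_piPrimePowBall`, `zero_mem_piPrimePowBall`,
  `exists_piPrimePowBall_subset_of_mem_nhds_zero` of `LocalPiSchwartzBruhatFourier`).

Written for the cell `hodgecm-mathlib` (fan B, rung B-IV, KEY `b4-howe-compact-irreducible`, helper H12 = the fibre
step of node E8 of `MoeglinVignerasWaldspurger1987.mvw_IV4_rankOne_irreducibleOrZero`): there `X = V = F_v^ι`,
`Y = Herm`, `Q` the moment map `x ↦ x x*`, whose fibres are `U(1)`-orbits (`Semilinear/RankOneHermitianRigidity*`),
`φ` a `U(1)`-invariant Schwartz–Bruhat function and `μ` a Haar measure.  Nothing number-theoretic is used or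
asserted here; the statements are elementary real analysis ([Folland1999]: §2.3 integrals of indicator / simple
functions, §4.4 compact sets and continuous images, §7.1 Radon measures — finite on compact sets; positivity on
non-empty open sets is the hypothesis `IsOpenPosMeasure`).

## References
* [Folland1999] G. B. Folland, *Real Analysis: Modern Techniques and Their Applications*, 2nd ed. (Wiley, 1999),
  §2.3, §4.4, §7.1.
-/

set_option autoImplicit false

noncomputable section

open _root_.MeasureTheory Set Filter
open scoped _root_.Topology Pointwise

namespace Literature.NumberTheory.Automorphic

variable {X Y : Type*} [TopologicalSpace X] [TopologicalSpace Y]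

/-! ## §1 An open neighbourhood of `Q u₀` whose preimage meets the support inside `S` -/

/-- **Rigid fibres have good neighbourhoods.**  Let `Q : X → Y` be continuous into a Hausdorff space, `φ` compactly
supported, `S ⊆ X` open, and suppose the fibre of `Q` through `u₀` meets `tsupport φ` inside `S`.  Then some open
`B ∋ Q u₀` has `Q⁻¹(B) ∩ tsupport φ ⊆ S`: the compact set `Q(tsupport φ \ S)` does not contain `Q u₀`, and
`B := (Q(tsupport φ \ S))ᶜ` works. [cite: Folland1999, §4.4] -/
theorem exists_isOpen_preimage_inter_tsupport_subset [T2Space Y] {E : Type*} [Zero E] {Q : X → Y}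
    (hQ : Continuous Q) {φ : X → E} (hφ : HasCompactSupport φ) {u₀ : X} {S : Set X} (hS : IsOpen S)
    (hfib : ∀ u ∈ tsupport φ, Q u = Q u₀ → u ∈ S) :
    ∃ B : Set Y, IsOpen B ∧ Q u₀ ∈ B ∧ Q ⁻¹' B ∩ tsupport φ ⊆ S := by
  have hK : IsCompact (tsupport φ \ S) := hφ.isCompact.diff hS
  refine ⟨(Q '' (tsupport φ \ S))ᶜ, (hK.image hQ).isClosed.isOpen_compl, ?_, ?_⟩
  · rintro ⟨u, ⟨huφ, huS⟩, hu⟩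
    exact huS (hfib u huφ hu)
  · rintro u ⟨huB, huφ⟩
    by_contra huS
    exact huB ⟨u, ⟨huφ, huS⟩, rfl⟩

/-! ## §2 The integral over `Q⁻¹(B)` and its positivity -/

omit [TopologicalSpace Y] in
/-- Pointwise: if `Q⁻¹(B) ∩ tsupport φ ⊆ S` and `φ = φ u₀` on `S`, then
`1_B(Q u) · φ(u) = φ(u₀) · 1_{Q⁻¹(B) ∩ tsupport φ}(u)` for every `u`. [cite: Folland1999, §2.3] -/
theorem indicator_comp_mul_eq_indicator_const {R : Type*} [MulZeroOneClass R] {Q : X → Y} {φ : X → R}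
    {u₀ : X} {S : Set X} (hφS : ∀ u ∈ S, φ u = φ u₀) {B : Set Y} (hBS : Q ⁻¹' B ∩ tsupport φ ⊆ S) (u : X) :
    B.indicator (fun _ => (1 : R)) (Q u) * φ u = (Q ⁻¹' B ∩ tsupport φ).indicator (fun _ => φ u₀) u := by
  by_cases huB : Q u ∈ B
  · by_cases huφ : u ∈ tsupport φ
    · rw [indicator_of_mem huB, one_mul,
        indicator_of_mem (show u ∈ Q ⁻¹' B ∩ tsupport φ from ⟨huB, huφ⟩)]
      exact hφS u (hBS ⟨huB, huφ⟩)
    · rw [image_eq_zero_of_notMem_tsupport huφ, mul_zero,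
        indicator_of_notMem (fun h : u ∈ Q ⁻¹' B ∩ tsupport φ => huφ h.2)]
  · rw [indicator_of_notMem huB, zero_mul,
      indicator_of_notMem (fun h : u ∈ Q ⁻¹' B ∩ tsupport φ => huB h.1)]

variable [MeasurableSpace X] [OpensMeasurableSpace X] {𝕜 : Type*} [RCLike 𝕜]

omit [TopologicalSpace X] [TopologicalSpace Y] [OpensMeasurableSpace X] in
/-- The two shapes of "the `Q`-push-forward of `φ μ` evaluated on `B`" agree:
`∫ 1_B(Q u) φ(u) dμ = ∫_{Q⁻¹ B} φ dμ` (for `Q⁻¹ B` measurable). [cite: Folland1999, §2.3] -/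
theorem integral_indicator_comp_mul_eq_setIntegral_preimage {μ : Measure X} {Q : X → Y} {φ : X → 𝕜}
    {B : Set Y} (hm : MeasurableSet (Q ⁻¹' B)) :
    ∫ u, B.indicator (fun _ => (1 : 𝕜)) (Q u) * φ u ∂μ = ∫ u in Q ⁻¹' B, φ u ∂μ := by
  rw [← integral_indicator hm]
  refine integral_congr_ae (Eventually.of_forall fun u => ?_)
  change B.indicator (fun _ => (1 : 𝕜)) (Q u) * φ u = (Q ⁻¹' B).indicator φ u
  by_cases hu : Q u ∈ B
  · rw [indicator_of_mem hu, one_mul, indicator_of_mem (show u ∈ Q ⁻¹' B from hu)]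
  · rw [indicator_of_notMem hu, zero_mul, indicator_of_notMem (show u ∉ Q ⁻¹' B from hu)]

/-- **The integral near a rigid fibre.**  If `B ⊆ Y` is open with `Q⁻¹(B) ∩ tsupport φ ⊆ S` and `φ = φ u₀` on `S`,
then `∫ 1_B(Q u) φ(u) dμ = μ(Q⁻¹ B ∩ tsupport φ) • φ u₀` (with Mathlib's convention `μ.real = 0` on sets of
infinite measure, where the left side is the junk value `0` as well). [cite: Folland1999, §2.3] -/
theorem integral_indicator_comp_mul_eq_measureReal_smul {μ : Measure X} {Q : X → Y} (hQ : Continuous Q)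
    {φ : X → 𝕜} {u₀ : X} {S : Set X} (hφS : ∀ u ∈ S, φ u = φ u₀) {B : Set Y} (hB : IsOpen B)
    (hBS : Q ⁻¹' B ∩ tsupport φ ⊆ S) :
    ∫ u, B.indicator (fun _ => (1 : 𝕜)) (Q u) * φ u ∂μ = μ.real (Q ⁻¹' B ∩ tsupport φ) • φ u₀ := by
  have hm : MeasurableSet (Q ⁻¹' B ∩ tsupport φ) :=
    (hB.preimage hQ).measurableSet.inter (isClosed_tsupport φ).measurableSet
  simp_rw [indicator_comp_mul_eq_indicator_const hφS hBS]
  exact integral_indicator_const (φ u₀) hm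

/-- **The integral over `Q⁻¹(B)` near a rigid fibre**: for `B` open with `Q⁻¹(B) ∩ tsupport φ ⊆ S` and `φ = φ u₀`
on `S`, `∫_{Q⁻¹ B} φ dμ = μ(Q⁻¹ B ∩ tsupport φ) • φ u₀`. [cite: Folland1999, §2.3] -/
theorem setIntegral_preimage_eq_measureReal_smul {μ : Measure X} {Q : X → Y} (hQ : Continuous Q)
    {φ : X → 𝕜} {u₀ : X} {S : Set X} (hφS : ∀ u ∈ S, φ u = φ u₀) {B : Set Y} (hB : IsOpen B)
    (hBS : Q ⁻¹' B ∩ tsupport φ ⊆ S) :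
    ∫ u in Q ⁻¹' B, φ u ∂μ = μ.real (Q ⁻¹' B ∩ tsupport φ) • φ u₀ := by
  rw [← integral_indicator_comp_mul_eq_setIntegral_preimage (hB.preimage hQ).measurableSet]
  exact integral_indicator_comp_mul_eq_measureReal_smul hQ hφS hB hBS

omit [OpensMeasurableSpace X] in
/-- **Positivity.**  If `μ` is positive on non-empty open sets and finite on compact sets, `φ` is compactly
supported and equal to `φ u₀ ≠ 0` on the open set `S ∋ u₀`, then `μ.real (Q⁻¹ B ∩ tsupport φ) > 0` for every open
`B ∋ Q u₀` (it contains the non-empty open set `Q⁻¹ B ∩ S` and lies in the compact `tsupport φ`). [cite: Folland1999, §7.1] -/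
theorem measureReal_preimage_inter_tsupport_pos {E : Type*} [Zero E] {μ : Measure X} [μ.IsOpenPosMeasure]
    [IsFiniteMeasureOnCompacts μ] {Q : X → Y} (hQ : Continuous Q) {φ : X → E} (hφ : HasCompactSupport φ)
    {u₀ : X} {S : Set X} (hS : IsOpen S) (hu₀ : u₀ ∈ S) (hφS : ∀ u ∈ S, φ u = φ u₀) (h0 : φ u₀ ≠ 0)
    {B : Set Y} (hB : IsOpen B) (hQB : Q u₀ ∈ B) : 0 < μ.real (Q ⁻¹' B ∩ tsupport φ) := by
  have hsub : Q ⁻¹' B ∩ S ⊆ Q ⁻¹' B ∩ tsupport φ := fun u hu =>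
    ⟨hu.1, subset_tsupport φ (by rw [Function.mem_support, hφS u hu.2]; exact h0)⟩
  have hpos : 0 < μ (Q ⁻¹' B ∩ S) := ((hB.preimage hQ).inter hS).measure_pos μ ⟨u₀, hQB, hu₀⟩
  rw [measureReal_def]
  exact ENNReal.toReal_pos (hpos.trans_le (measure_mono hsub)).ne'
    (ne_top_of_le_ne_top hφ.isCompact.measure_ne_top (measure_mono inter_subset_right))

/-! ## §3 Vanishing at `u₀` -/

/-- **Main lemma (set-integral form).**  `Y` Hausdorff, `μ` positive on non-empty open sets and finite on compact
sets, `Q` continuous, `φ` compactly supported, `S ∋ u₀` open with `φ = φ u₀` on `S` and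
`{u ∈ tsupport φ | Q u = Q u₀} ⊆ S`.  If arbitrarily small open neighbourhoods `B` of `Q u₀` have
`∫_{Q⁻¹ B} φ dμ = 0`, then `φ u₀ = 0`.  (By §1 pick `B₀` with `Q⁻¹ B₀ ∩ tsupport φ ⊆ S`; a vanishing `B ⊆ B₀` gives
`0 = μ(Q⁻¹ B ∩ tsupport φ) • φ u₀` by §2, and the measure is positive if `φ u₀ ≠ 0`.) [cite: Folland1999, §7.1] -/
theorem eq_zero_of_forall_exists_setIntegral_preimage_eq_zero [T2Space Y] {μ : Measure X}
    [μ.IsOpenPosMeasure] [IsFiniteMeasureOnCompacts μ] {Q : X → Y} (hQ : Continuous Q) {φ : X → 𝕜}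
    (hφ : HasCompactSupport φ) {u₀ : X} {S : Set X} (hS : IsOpen S) (hu₀ : u₀ ∈ S)
    (hφS : ∀ u ∈ S, φ u = φ u₀) (hfib : ∀ u ∈ tsupport φ, Q u = Q u₀ → u ∈ S)
    (h : ∀ B₀ ∈ 𝓝 (Q u₀), ∃ B ⊆ B₀, IsOpen B ∧ Q u₀ ∈ B ∧ ∫ u in Q ⁻¹' B, φ u ∂μ = 0) :
    φ u₀ = 0 := by
  by_contra h0
  obtain ⟨B₀, hB₀, hQB₀, hB₀S⟩ := exists_isOpen_preimage_inter_tsupport_subset hQ hφ hS hfib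
  obtain ⟨B, hBB₀, hB, hQB, hint⟩ := h B₀ (hB₀.mem_nhds hQB₀)
  have hBS : Q ⁻¹' B ∩ tsupport φ ⊆ S := fun u hu => hB₀S ⟨hBB₀ hu.1, hu.2⟩
  rw [setIntegral_preimage_eq_measureReal_smul hQ hφS hB hBS, smul_eq_zero] at hint
  rcases hint with hm | hφ0
  · exact (measureReal_preimage_inter_tsupport_pos hQ hφ hS hu₀ hφS h0 hB hQB).ne' hm
  · exact h0 hφ0

/-- Variant of the main lemma with the hypothesis for ALL open `B ∋ Q u₀`. [cite: Folland1999, §7.1] -/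
theorem eq_zero_of_forall_isOpen_setIntegral_preimage_eq_zero [T2Space Y] {μ : Measure X}
    [μ.IsOpenPosMeasure] [IsFiniteMeasureOnCompacts μ] {Q : X → Y} (hQ : Continuous Q) {φ : X → 𝕜}
    (hφ : HasCompactSupport φ) {u₀ : X} {S : Set X} (hS : IsOpen S) (hu₀ : u₀ ∈ S)
    (hφS : ∀ u ∈ S, φ u = φ u₀) (hfib : ∀ u ∈ tsupport φ, Q u = Q u₀ → u ∈ S)
    (h : ∀ B : Set Y, IsOpen B → Q u₀ ∈ B → ∫ u in Q ⁻¹' B, φ u ∂μ = 0) : φ u₀ = 0 :=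
  eq_zero_of_forall_exists_setIntegral_preimage_eq_zero hQ hφ hS hu₀ hφS hfib fun B₀ hB₀ =>
    ⟨interior B₀, interior_subset, isOpen_interior, mem_interior_iff_mem_nhds.mpr hB₀,
      h _ isOpen_interior (mem_interior_iff_mem_nhds.mpr hB₀)⟩

/-- **Main lemma (indicator form)**: the same with the vanishing hypothesis written as
`∫ 1_B(Q u) φ(u) dμ = 0`. [cite: Folland1999, §7.1] -/
theorem eq_zero_of_forall_exists_integral_indicator_comp_mul_eq_zero [T2Space Y] {μ : Measure X}
    [μ.IsOpenPosMeasure] [IsFiniteMeasureOnCompacts μ] {Q : X → Y} (hQ : Continuous Q) {φ : X → 𝕜}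
    (hφ : HasCompactSupport φ) {u₀ : X} {S : Set X} (hS : IsOpen S) (hu₀ : u₀ ∈ S)
    (hφS : ∀ u ∈ S, φ u = φ u₀) (hfib : ∀ u ∈ tsupport φ, Q u = Q u₀ → u ∈ S)
    (h : ∀ B₀ ∈ 𝓝 (Q u₀), ∃ B ⊆ B₀, IsOpen B ∧ Q u₀ ∈ B ∧
      ∫ u, B.indicator (fun _ => (1 : 𝕜)) (Q u) * φ u ∂μ = 0) :
    φ u₀ = 0 :=
  eq_zero_of_forall_exists_setIntegral_preimage_eq_zero hQ hφ hS hu₀ hφS hfib fun B₀ hB₀ => by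
    obtain ⟨B, hBB₀, hB, hQB, hint⟩ := h B₀ hB₀
    rw [integral_indicator_comp_mul_eq_setIntegral_preimage (hB.preimage hQ).measurableSet] at hint
    exact ⟨B, hBB₀, hB, hQB, hint⟩

/-- **Main lemma for locally constant `φ`.**  `Y` Hausdorff, `μ` positive on non-empty open sets and finite on
compact sets, `Q` continuous, `φ` compactly supported, locally constant, and constant along the fibre of `Q` through
`u₀` inside its support.  If arbitrarily small open `B ∋ Q u₀` have `∫_{Q⁻¹ B} φ dμ = 0`, then `φ u₀ = 0`
(the set-integral main lemma with `S := {u | φ u = φ u₀}`). [cite: Folland1999, §7.1] -/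
theorem eq_zero_of_isLocallyConstant_of_forall_exists_setIntegral_preimage_eq_zero [T2Space Y] {μ : Measure X}
    [μ.IsOpenPosMeasure] [IsFiniteMeasureOnCompacts μ] {Q : X → Y} (hQ : Continuous Q) {φ : X → 𝕜}
    (hφ : HasCompactSupport φ) (hlc : IsLocallyConstant φ) {u₀ : X}
    (hfib : ∀ u ∈ tsupport φ, Q u = Q u₀ → φ u = φ u₀)
    (h : ∀ B₀ ∈ 𝓝 (Q u₀), ∃ B ⊆ B₀, IsOpen B ∧ Q u₀ ∈ B ∧ ∫ u in Q ⁻¹' B, φ u ∂μ = 0) :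
    φ u₀ = 0 :=
  eq_zero_of_forall_exists_setIntegral_preimage_eq_zero (μ := μ) (S := {u | φ u = φ u₀}) hQ hφ
    (hlc.isOpen_fiber (φ u₀)) rfl (fun _ hu => hu) hfib h

/-! ## §4 Translates of a shrinking family of open sets (topological additive groups) -/

/-- **Main lemma, translate form.**  Let `Y` be a Hausdorff topological additive group and `s i` (`i : I`) open
sets containing `0` such that every neighbourhood of `0` contains some `s i`.  Under the hypotheses of the main
lemma, if `∫_{Q⁻¹(Q u₀ +ᵥ s i)} φ dμ = 0` for every `i`, then `φ u₀ = 0`.  (In the tree's use `Y = F^ι` and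
`s N = (𝔭^N)^ι`.) [cite: Folland1999, §7.1] -/
theorem eq_zero_of_forall_setIntegral_preimage_vadd_eq_zero [T2Space Y] [AddGroup Y] [IsTopologicalAddGroup Y]
    {μ : Measure X} [μ.IsOpenPosMeasure] [IsFiniteMeasureOnCompacts μ] {Q : X → Y} (hQ : Continuous Q)
    {φ : X → 𝕜} (hφ : HasCompactSupport φ) {u₀ : X} {S : Set X} (hS : IsOpen S) (hu₀ : u₀ ∈ S)
    (hφS : ∀ u ∈ S, φ u = φ u₀) (hfib : ∀ u ∈ tsupport φ, Q u = Q u₀ → u ∈ S)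
    {I : Type*} {s : I → Set Y} (hso : ∀ i, IsOpen (s i)) (hs0 : ∀ i, (0 : Y) ∈ s i)
    (hsb : ∀ W ∈ 𝓝 (0 : Y), ∃ i, s i ⊆ W)
    (h : ∀ i, ∫ u in Q ⁻¹' (Q u₀ +ᵥ s i), φ u ∂μ = 0) : φ u₀ = 0 := by
  refine eq_zero_of_forall_exists_setIntegral_preimage_eq_zero (μ := μ) hQ hφ hS hu₀ hφS hfib
    fun B₀ hB₀ => ?_
  have hW : (fun y : Y => Q u₀ + y) ⁻¹' B₀ ∈ 𝓝 (0 : Y) :=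
    (continuous_const.add continuous_id).continuousAt.preimage_mem_nhds (by simpa using hB₀)
  obtain ⟨i, hi⟩ := hsb _ hW
  refine ⟨Q u₀ +ᵥ s i, ?_, (hso i).vadd (Q u₀), ⟨0, hs0 i, by simp⟩, h i⟩
  rintro _ ⟨y, hy, rfl⟩
  exact hi hy

/-- **Main lemma, translate form, `φ` locally constant** (`S := {φ = φ u₀}`): the shape consumed downstream with
`Y = F^ι`, `s N = (𝔭^N)^ι` and the vanishing supplied by `setIntegral_preimage_vadd_piPrimePowBall_eq_zero`.
[cite: Folland1999, §7.1] -/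
theorem eq_zero_of_isLocallyConstant_of_forall_setIntegral_preimage_vadd_eq_zero [T2Space Y] [AddGroup Y]
    [IsTopologicalAddGroup Y] {μ : Measure X} [μ.IsOpenPosMeasure] [IsFiniteMeasureOnCompacts μ] {Q : X → Y}
    (hQ : Continuous Q) {φ : X → 𝕜} (hφ : HasCompactSupport φ) (hlc : IsLocallyConstant φ) {u₀ : X}
    (hfib : ∀ u ∈ tsupport φ, Q u = Q u₀ → φ u = φ u₀)
    {I : Type*} {s : I → Set Y} (hso : ∀ i, IsOpen (s i)) (hs0 : ∀ i, (0 : Y) ∈ s i)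
    (hsb : ∀ W ∈ 𝓝 (0 : Y), ∃ i, s i ⊆ W)
    (h : ∀ i, ∫ u in Q ⁻¹' (Q u₀ +ᵥ s i), φ u ∂μ = 0) : φ u₀ = 0 :=
  eq_zero_of_forall_setIntegral_preimage_vadd_eq_zero (μ := μ) (S := {u | φ u = φ u₀}) hQ hφ
    (hlc.isOpen_fiber (φ u₀)) rfl (fun _ hu => hu) hfib hso hs0 hsb h

end Literature.NumberTheory.Automorphic

end
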